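import Mathlib
import Summits.AtomisticToContinuum.Crystallization.Theses.ReggeStarCoercivity
import Literature.Barriers.AtomisticToContinuum.TetrahedralFrustration
import Literature.MathematicalPhysics.StatisticalMechanics.Crystallization

/-!
# `LevelOneFrustrationGap` — the raw level-1 simplex bound leaks for the bond energy

Route `ReggeStarCoercivity` (sub-problem `Crystallization` of `AtomisticToContinuum`), support item
`stmt-AtomisticToContinuum-13609`: the certified number

  `−θ / (4 (3 θ − π)) < 6 · V(1) + V(√2)`,  `θ = arccos (1/3)`, `V = lennardJones`,

i.e. the angle-weighted Lennard-Jones energy per unit particle-weight of the regular unit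
tetrahedron (`≈ −0.5582`) lies strictly below the Delaunay-edge energy per particle of the unit fcc
lattice (`6·(−1/12) + V(√2) = −133/256 ≈ −0.5195`); the energy twin of Rogers's simplex bound
versus the fcc density.

PROOF. `V(√2) = (1/12)·(1/64) − (1/6)·(1/8) = −5/256` since `((√2)⁻¹)² = 1/2`, so the right-hand
side is the rational `−133/256`. On the left, `θ = tetDihedralAngle` by definition, with the tree's
bracket `1.230956 < θ < 1.23098` (`tetDihedralAngle_bounds`) and `π/3 < θ`
(`pi_div_three_lt`), so the denominator `4 (3 θ − π)` is positive; clearing it, the claim is the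
linear inequality `335 θ < 133 π`, which follows from `θ < 1.23098` and `3.141592 < π`
(`Real.pi_gt_d6`): `335 · 1.23098 = 412.3783 < 417.8317 = 133 · 3.141592`.
-/

namespace Summit.AtomisticToContinuum.Crystallization.Theorems

open Literature.MathematicalPhysics.StatisticalMechanics
open Literature.Barriers.AtomisticToContinuum

/-- `V(√2) = −5/256` for the Blanc–Lewin Lennard-Jones potential `V(r) = r⁻¹²/12 − r⁻⁶/6`
(second-neighbour bond of the unit fcc lattice): `((√2)⁻¹)⁶ = 1/8`, `((√2)⁻¹)¹² = 1/64`. -/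
theorem lennardJones_sqrt_two : lennardJones (Real.sqrt 2) = -5 / 256 := by
  unfold lennardJones
  have h2 : ((Real.sqrt 2)⁻¹) ^ 2 = 1 / 2 := by
    rw [inv_pow, Real.sq_sqrt (by norm_num : (0 : ℝ) ≤ 2)]
    norm_num
  have h6 : ((Real.sqrt 2)⁻¹) ^ 6 = 1 / 8 := by
    rw [show ((Real.sqrt 2)⁻¹) ^ 6 = (((Real.sqrt 2)⁻¹) ^ 2) ^ 3 by ring, h2]; norm_num
  have h12 : ((Real.sqrt 2)⁻¹) ^ 12 = 1 / 64 := by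
    rw [show ((Real.sqrt 2)⁻¹) ^ 12 = (((Real.sqrt 2)⁻¹) ^ 2) ^ 6 by ring, h2]; norm_num
  rw [h6, h12]; norm_num

/-- **Settles `stmt-AtomisticToContinuum-13609`** (`ReggeStarCoercivity.LevelOneFrustrationGap`):
`−θ/(4(3θ−π)) < 6·V(1) + V(√2)` with `θ = arccos(1/3)`: the right-hand side is `−133/256`
(`lennardJones_one`, `lennardJones_sqrt_two`), the denominator `4(3θ − π)` is positive
(`pi_div_three_lt`), and after clearing it the claim is `335 θ < 133 π`, immediate from
`θ < 1.23098` (`tetDihedralAngle_bounds`) and `3.141592 < π` (`Real.pi_gt_d6`). -/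
theorem levelOneFrustrationGap_proof :
    Summit.AtomisticToContinuum.Crystallization.Theses.ReggeStarCoercivity.LevelOneFrustrationGap := by
  unfold Summit.AtomisticToContinuum.Crystallization.Theses.ReggeStarCoercivity.LevelOneFrustrationGap
  rw [lennardJones_sqrt_two, lennardJones_one]
  have hθ : Real.arccos (1 / 3) = tetDihedralAngle := rfl
  rw [hθ]
  obtain ⟨_, h2⟩ := tetDihedralAngle_bounds
  have h3 := pi_div_three_lt
  have hπ := Real.pi_gt_d6
  have hD : 0 < 4 * (3 * tetDihedralAngle - Real.pi) := by linarith
  rw [neg_lt, lt_div_iff₀ hD]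
  nlinarith

end Summit.AtomisticToContinuum.Crystallization.Theorems
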